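import Literature.Probability.RandomPlanarGeometry.SAWWordAutomata
import Mathlib.Analysis.SpecialFunctions.Pow.Real
import Mathlib.Analysis.SpecificLimits.Basic
import Std.Data.HashMap
import HarnessLib

/-!
# Finite-memory automata (Pönitz–Tittmann) and certified upper bounds `μ(ℤ²) ≤ N/D`

Topic `Literature/Probability/RandomPlanarGeometry` (continues `SAWWordAutomata.lean`). Pönitz and
Tittmann (2000) bound the connective constant from above by the growth rate of the *walks with
memory `k`* (no loop of length `≤ k`), computed as the largest eigenvalue of an automatically
generated automaton whose states are the walk suffixes that can still be closed to a loop within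
the memory (`|a| + ‖end a‖₁ ≤ k`). This file makes that bound kernel-checkable:

* `FiniteMemory.ptStep K` — the automaton on step words (`SAWWords.lean`): append the letter, kill
  the run if the suffix closes a loop, otherwise truncate to the longest closable suffix; it is
  proved that **every self-avoiding word survives** (`run_ne_none_of_isSAW`: the state is always a
  suffix of the input, and a suffix of a self-avoiding word is self-avoiding);
* `FiniteMemory.check K N D iters` — an executable certificate check: an (untrusted) breadth-first
  search enumerates the reachable states and an integer power iteration proposes a weight `v`;
  the (verified) function `verify` then checks closure and the Collatz–Wielandt inequalities
  `D Σ_d v(ptStep a d) ≤ N v(a)`, i.e. a `WordAutomaton.Certificate`;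
* `count_mul_pow_le_of_check : check K N D iters = true → cₙ Dⁿ ≤ Nⁿ 2⁴¹` and
  **`connectiveConstant_le_of_check : check K N D iters = true → μ(ℤ²) ≤ N/D`**.

The evaluation `check 16 2695 1000 50 = true` (467 249 states, P–T Table 2: `μ ≤ 2.6939` for
`k = 16`) is one `native_decide` in `SAWFiniteMemory16.lean`, giving `μ(ℤ²) ≤ 2.695 ≤ 2.7`.

## References

* A. Pönitz, P. Tittmann, *Improved upper bounds for self-avoiding walks in ℤᵈ*, Electron. J.
  Combin. 7 (2000) R21, §2 (the automaton), §3 (eigenvalue bound), Table 2.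
* N. Madras, G. Slade, *The Self-Avoiding Walk* (1993), §1.2 (`μ = infₙ cₙ^{1/n}`).
-/

open Finset Filter Topology Literature.Probability.LatticeModels
open scoped BigOperators

namespace Literature.Probability.RandomPlanarGeometry.SAW

namespace FiniteMemory

/-! ### Integer-pair coordinates (the executable model) -/

/-- The pair of coordinates of a site of `ℤ²`. [folklore] -/
def toPair (x : Site 2) : ℤ × ℤ := (x 0, x 1)

/-- `toPair` is injective. [folklore] -/
theorem toPair_injective : Function.Injective toPair := by
  intro x y h
  simp only [toPair, Prod.mk.injEq] at h
  funext i
  fin_cases i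
  · exact h.1
  · exact h.2

/-- Move the pair `p` by one step in direction `d`. [folklore] -/
def pxy (d : Step) (p : ℤ × ℤ) : ℤ × ℤ := (p.1 + Step.dx d, p.2 + Step.dy d)

/-- `toPair (x + vec d) = pxy d (toPair x)`. [folklore] -/
@[simp] theorem toPair_add_vec (x : Site 2) (d : Step) : toPair (x + Step.vec d) = pxy d (toPair x) := by
  simp [toPair, pxy]

/-- Endpoint of a word in pair coordinates (left fold). [folklore] -/
def pEnd (a : List Step) : ℤ × ℤ := a.foldl (fun p d => pxy d p) (0, 0)

/-- The visited vertices of a word in pair coordinates (`List.scanl`). [folklore] -/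
def pVerts (a : List Step) : List (ℤ × ℤ) := a.scanl (fun p d => pxy d p) (0, 0)

/-- `ℓ¹` distance of two pairs. [folklore] -/
def dist1 (p q : ℤ × ℤ) : ℕ := (p.1 - q.1).natAbs + (p.2 - q.2).natAbs

/-- Folding the steps of `a` from `toPair x` reaches `toPair (x + wEnd a)`. [folklore] -/
theorem foldl_pxy_eq (a : List Step) (x : Site 2) :
    a.foldl (fun p d => pxy d p) (toPair x) = toPair (x + wEnd a) := by
  induction a generalizing x with
  | nil => simp
  | cons d a ih =>
    rw [List.foldl_cons, ← toPair_add_vec, ih, wEnd_cons, add_assoc]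

/-- `pEnd a = toPair (wEnd a)`. [folklore] -/
theorem pEnd_eq (a : List Step) : pEnd a = toPair (wEnd a) := by
  have := foldl_pxy_eq a 0
  rw [zero_add] at this
  rw [← this, pEnd]
  rfl

/-- Membership in a `scanl`: the partial folds. [folklore] -/
theorem mem_scanl_iff {α β : Type*} (f : β → α → β) (b : β) (l : List α) (q : β) :
    q ∈ List.scanl f b l ↔ ∃ i ≤ l.length, q = List.foldl f b (l.take i) := by
  induction l generalizing b with
  | nil => simp
  | cons x l ih =>
    rw [List.scanl_cons, List.mem_cons, ih]
    constructor
    · rintro (rfl | ⟨i, hi, rfl⟩)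
      · exact ⟨0, Nat.zero_le _, rfl⟩
      · exact ⟨i + 1, by simpa using hi, rfl⟩
    · rintro ⟨i, hi, rfl⟩
      cases i with
      | zero => exact Or.inl rfl
      | succ i => exact Or.inr ⟨i, by simpa using hi, rfl⟩

/-- The vertices of `pVerts a` are the `toPair (traj a i)`, `i ≤ |a|`. [folklore] -/
theorem mem_pVerts_iff (a : List Step) (q : ℤ × ℤ) :
    q ∈ pVerts a ↔ ∃ i ≤ a.length, q = toPair (traj a i) := by
  rw [pVerts, mem_scanl_iff]
  refine exists_congr fun i => and_congr_right fun _ => ?_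
  have := foldl_pxy_eq (a.take i) 0
  rw [zero_add] at this
  rw [traj, ← this]
  rfl

/-! ### The Pönitz–Tittmann automaton -/

/-- **One step of the memory-`K` automaton** (Pönitz–Tittmann 2000, §2, "automatic generation of
finite automata for counting walks with finite memory"): from the state `a` (a step word, the
remembered suffix) on the letter `d`, kill the run if the new endpoint is a vertex of `a` (a loop
of length `≤ K` closes), otherwise keep the longest suffix `b` of `a ++ [d]` with
`|b| + ‖start b - end b‖₁ ≤ K` (the part that can still contribute to a loop of length `≤ K`).
[cite: PonitzTittmann2000, §2] -/
def ptStep (K : ℕ) (a : List Step) (d : Step) : Option (List Step) :=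
  let e := pxy d (pEnd a)
  let vs := pVerts a
  if e ∈ vs then none
  else
    let L := a.length + 1
    let j := ((vs.zipIdx).takeWhile fun pi => decide (K < (L - pi.2) + dist1 pi.1 e)).length
    some ((a ++ [d]).drop j)

/-- The new state is a suffix of the old state with the letter appended. [folklore] -/
theorem ptStep_suffix {K : ℕ} {a b : List Step} {d : Step} (h : ptStep K a d = some b) :
    b <:+ a ++ [d] := by
  unfold ptStep at h
  simp only at h
  split_ifs at h
  rw [Option.some.injEq] at h
  rw [← h]
  exact List.drop_suffix _ _

/-- A self-avoiding input is never killed: if `a ++ [d]` is self-avoiding then `ptStep K a d`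
is defined. [cite: PonitzTittmann2000, §2] -/
theorem ptStep_ne_none {K : ℕ} {a : List Step} {d : Step} (h : IsSAW (a ++ [d])) :
    ptStep K a d ≠ none := by
  unfold ptStep
  simp only
  split_ifs with hmem
  · exfalso
    obtain ⟨i, hi, he⟩ := (mem_pVerts_iff a _).1 hmem
    rw [pEnd_eq, ← toPair_add_vec] at he
    have he' := toPair_injective he
    -- `traj (a ++ [d]) (|a| + 1) = traj (a ++ [d]) i` with `i ≤ |a|`
    have h1 : traj (a ++ [d]) (a.length + 1) = wEnd a + Step.vec d := by
      rw [traj_append_right a [d] 1]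
      simp [traj]
    have h2 : traj (a ++ [d]) i = traj a i := traj_append_left a [d] hi
    have hinj := (isSAW_iff_injOn _).1 h
    have := hinj (show a.length + 1 ∈ {j | j ≤ (a ++ [d]).length} by simp)
      (show i ∈ {j | j ≤ (a ++ [d]).length} by simp; omega) (by rw [h1, h2, he'])
    omega
  · exact Option.some_ne_none _

/-- **Every self-avoiding word survives the memory-`K` automaton**, and its state is a suffix of
the word read. [cite: PonitzTittmann2000, §2] -/
theorem run_eq_some_of_isSAW (K : ℕ) (w : List Step) (h : IsSAW w) :
    ∃ a, WordAutomaton.run (ptStep K) w = some a ∧ a <:+ w := by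
  induction w using List.reverseRecOn with
  | nil => exact ⟨[], rfl, List.suffix_refl _⟩
  | append_singleton w d ih =>
    have hw : IsSAW w := by simpa using h.take w.length
    obtain ⟨a, ha, hsuf⟩ := ih hw
    obtain ⟨t, rfl⟩ := hsuf
    have had : IsSAW (a ++ [d]) := by
      have := h.drop t.length
      simpa using this
    cases hs : ptStep K a d with
    | none => exact absurd hs (ptStep_ne_none had)
    | some b =>
      refine ⟨b, by rw [WordAutomaton.run_append_singleton, ha, Option.bind_some, hs], ?_⟩
      exact (ptStep_suffix hs).trans ⟨t, (List.append_assoc t a [d]).symm⟩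

/-- Self-avoiding words are live for `ptStep K`. [cite: PonitzTittmann2000, §2] -/
theorem run_ne_none_of_isSAW (K : ℕ) (w : List Step) (h : IsSAW w) :
    WordAutomaton.run (ptStep K) w ≠ none := by
  obtain ⟨a, ha, -⟩ := run_eq_some_of_isSAW K w h
  rw [ha]
  exact Option.some_ne_none a

/-! ### The certificate: untrusted search -/

/-- Breadth-first enumeration of the states reachable from `[]` (fuelled; untrusted — only its
output is checked). [cite: PonitzTittmann2000, §2] -/
def bfs (K : ℕ) : Array (List Step) × Std.HashMap (List Step) ℕ := Id.run do
  let mut states : Array (List Step) := #[[]]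
  let mut idx : Std.HashMap (List Step) ℕ := (Std.HashMap.emptyWithCapacity 1000000).insert [] 0
  let mut i := 0
  let mut fuel := 20000000
  while i < states.size && fuel > 0 do
    fuel := fuel - 1
    let a := states[i]!
    for d in List.finRange 4 do
      match ptStep K a d with
      | none => pure ()
      | some b =>
        if !idx.contains b then
          idx := idx.insert b states.size
          states := states.push b
    i := i + 1
  return (states, idx)

/-- Successor indices of every state (untrusted). [folklore] -/
def transTable (K : ℕ) (states : Array (List Step)) (idx : Std.HashMap (List Step) ℕ) :
    Array (Array ℕ) :=
  states.map fun a => Id.run do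
    let mut acc : Array ℕ := #[]
    for d in List.finRange 4 do
      match ptStep K a d with
      | none => pure ()
      | some b => acc := acc.push (idx.getD b 0)
    return acc

/-- Integer power iteration towards the Perron eigenvector, normalised to `max ≈ 2⁴⁰`,
entries `≥ 1` (untrusted). [cite: PonitzTittmann2000, §3] -/
def powerIter (T : Array (Array ℕ)) (iters : ℕ) : Array ℕ := Id.run do
  let n := T.size
  let mut v : Array ℕ := Array.replicate n (2 ^ 20)
  for _ in [0:iters] do
    let mut w : Array ℕ := Array.replicate n 0
    let mut mx : ℕ := 1
    for i in [0:n] do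
      let s := (T[i]!).foldl (fun acc j => acc + v[j]!) 0
      w := w.set! i s
      if s > mx then mx := s
    v := w.map fun s => s * 2 ^ 40 / mx + 1
  return v

/-- The search: states, index, proposed weights (untrusted). [folklore] -/
def search (K iters : ℕ) : Array (List Step) × Std.HashMap (List Step) ℕ × Array ℕ :=
  let (states, idx) := bfs K
  (states, idx, powerIter (transTable K states idx) iters)

/-! ### The certificate: verified check -/

/-- The weight function encoded by the arrays: `v[idx[a]]` (`0` off the table). [folklore] -/
def weightOf (idx : Std.HashMap (List Step) ℕ) (v : Array ℕ) (a : List Step) : ℕ :=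
  match idx[a]? with
  | none => 0
  | some j => v[j]?.getD 0

/-- Check of the state number `i`: consistent index, positive weight, successors in the table,
Collatz–Wielandt inequality. [cite: PonitzTittmann2000, §3] -/
def verifyState (K N D : ℕ) (states : Array (List Step)) (idx : Std.HashMap (List Step) ℕ)
    (v : Array ℕ) (i : ℕ) : Bool :=
  match states[i]?, v[i]? with
  | some a, some vi =>
    decide (idx[a]? = some i) && decide (1 ≤ vi) &&
      (List.finRange 4).all (fun d =>
        match ptStep K a d with
        | none => true
        | some b =>
          match idx[b]? with
          | none => false
          | some j => decide (states[j]? = some b)) &&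
      decide (D * (List.ofFn fun d : Step => ((ptStep K a d).map (weightOf idx v)).getD 0).sum
        ≤ N * vi)
  | _, _ => false

/-- The verified part of the certificate check. [cite: PonitzTittmann2000, §3] -/
def verify (K N D : ℕ) (states : Array (List Step)) (idx : Std.HashMap (List Step) ℕ)
    (v : Array ℕ) : Bool :=
  decide (states[0]? = some []) && decide (weightOf idx v [] ≤ 2 ^ 41) &&
    (List.range states.size).all (verifyState K N D states idx v)

/-- **The certificate check** `check K N D iters`: search, then verify. Only ever evaluated by
`native_decide` (see `SAWFiniteMemory16.lean`). [cite: PonitzTittmann2000, §3] -/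
@[irreducible] def check (K N D iters : ℕ) : Bool :=
  let r := search K iters
  verify K N D r.1 r.2.1 r.2.2

/-- **Soundness of `verify`**: a successful check yields a Collatz–Wielandt certificate for
`ptStep K` on the set of tabulated states, with `v([]) ≤ 2⁴¹`. [cite: PonitzTittmann2000, §3] -/
theorem certificate_of_verify {K N D : ℕ} {states : Array (List Step)}
    {idx : Std.HashMap (List Step) ℕ} {v : Array ℕ} (h : verify K N D states idx v = true) :
    WordAutomaton.Certificate (ptStep K) {a | ∃ i < states.size, states[i]? = some a}
      (weightOf idx v) N D ∧ weightOf idx v [] ≤ 2 ^ 41 := by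
  simp only [verify, Bool.and_eq_true, decide_eq_true_eq, List.all_eq_true, List.mem_range] at h
  obtain ⟨⟨h0, hroot⟩, hall⟩ := h
  -- unpack the check of a tabulated state
  have key : ∀ a : List Step, ∀ i < states.size, states[i]? = some a →
      idx[a]? = some i ∧ 1 ≤ weightOf idx v a ∧
      (∀ d b, ptStep K a d = some b → ∃ j < states.size, states[j]? = some b) ∧
      D * ∑ d : Step, ((ptStep K a d).map (weightOf idx v)).getD 0 ≤ N * weightOf idx v a := by
    intro a i hi ha
    have hs := hall i hi
    unfold verifyState at hs
    rw [ha] at hs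
    cases hv : v[i]? with
    | none => simp [hv] at hs
    | some vi =>
      simp only [hv, Bool.and_eq_true, decide_eq_true_eq, List.all_eq_true] at hs
      obtain ⟨⟨⟨hidx, hvi⟩, hsucc⟩, hcw⟩ := hs
      have hw : weightOf idx v a = vi := by simp [weightOf, hidx, hv]
      refine ⟨hidx, hw ▸ hvi, fun d b hb => ?_, ?_⟩
      · have := hsucc d (List.mem_finRange d)
        rw [hb] at this
        cases hj : idx[b]? with
        | none => simp [hj] at this
        | some j =>
          simp only [hj, decide_eq_true_eq] at this
          exact ⟨j, (Array.getElem?_eq_some_iff.1 this).1, this⟩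
      · rw [hw, ← List.sum_ofFn]
        exact hcw
  refine ⟨⟨?_, ?_, ?_, ?_⟩, hroot⟩
  · exact ⟨0, (Array.getElem?_eq_some_iff.1 h0).1, h0⟩
  · rintro a ⟨i, hi, ha⟩ d b hb
    exact (key a i hi ha).2.2.1 d b hb
  · rintro a ⟨i, hi, ha⟩
    exact (key a i hi ha).2.1
  · rintro a ⟨i, hi, ha⟩
    exact (key a i hi ha).2.2.2

/-- **`cₙ · Dⁿ ≤ Nⁿ · 2⁴¹`** from a successful certificate check. [cite: PonitzTittmann2000, §3] -/
theorem count_mul_pow_le_of_check {K N D iters : ℕ} (h : check K N D iters = true) (n : ℕ) :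
    count n * D ^ n ≤ N ^ n * 2 ^ 41 := by
  rw [check] at h
  obtain ⟨hc, hroot⟩ := certificate_of_verify h
  exact le_trans (WordAutomaton.count_mul_pow_le hc (run_ne_none_of_isSAW K) n)
    (Nat.mul_le_mul_left _ hroot)

/-! ### The bound on the connective constant -/

/-- `C^{1/(n+1)} → 1` for `C > 0`. [folklore] -/
theorem tendsto_const_rpow_inv {C : ℝ} (hC : 0 < C) :
    Tendsto (fun n : ℕ => C ^ ((n : ℝ) + 1)⁻¹) atTop (𝓝 1) := by
  have h1 : Tendsto (fun n : ℕ => Real.log C / ((n : ℝ) + 1)) atTop (𝓝 0) := by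
    have := tendsto_const_div_atTop_nhds_zero_nat (Real.log C)
    exact (this.comp (tendsto_add_atTop_nat 1)).congr fun n => by simp
  have h2 := (Real.continuous_exp.tendsto 0).comp h1
  rw [Real.exp_zero] at h2
  refine h2.congr fun n => ?_
  simp only [Function.comp_apply]
  rw [Real.rpow_def_of_pos hC, div_eq_mul_inv]

/-- **`μ(ℤ²) ≤ N/D` from a successful certificate check** (`μ ≤ cₙ^{1/n} ≤ (N/D)·2^{41/n} → N/D`).
[cite: PonitzTittmann2000, §3] -/
theorem connectiveConstant_le_of_check {K N D iters : ℕ} (h : check K N D iters = true)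
    (hD : 0 < D) : connectiveConstant ≤ (N : ℝ) / D := by
  have hND : (0 : ℝ) ≤ (N : ℝ) / D := by positivity
  set C : ℝ := (2 : ℝ) ^ 41 with hC_def
  have hC : 0 < C := by positivity
  -- μ ≤ (N/D) · C^{1/(n+1)} for every n
  have hle : ∀ n : ℕ, connectiveConstant ≤ (N : ℝ) / D * C ^ ((n : ℝ) + 1)⁻¹ := by
    intro n
    have hn : (n + 1 : ℕ) ≠ 0 := Nat.succ_ne_zero n
    have h1 : connectiveConstant ≤ (count (n + 1) : ℝ) ^ (1 / ((n : ℝ) + 1)) := by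
      have := Zd.connectiveConstant_le_rpow (d := 2) hn
      rw [Zd.connectiveConstant_two, Zd.count_two] at this
      simpa [Nat.cast_succ] using this
    have h2 : (count (n + 1) : ℝ) ≤ ((N : ℝ) / D) ^ (n + 1) * C := by
      have h3 := count_mul_pow_le_of_check h (n + 1)
      have h4 : (count (n + 1) : ℝ) * (D : ℝ) ^ (n + 1) ≤ (N : ℝ) ^ (n + 1) * C := by
        rw [hC_def]; exact_mod_cast h3
      have hDpos : (0 : ℝ) < (D : ℝ) ^ (n + 1) := by positivity
      rw [div_pow, div_mul_eq_mul_div, le_div_iff₀ hDpos]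
      exact h4
    have hexp : (0 : ℝ) ≤ 1 / ((n : ℝ) + 1) := by positivity
    calc connectiveConstant ≤ (count (n + 1) : ℝ) ^ (1 / ((n : ℝ) + 1)) := h1
      _ ≤ (((N : ℝ) / D) ^ (n + 1) * C) ^ (1 / ((n : ℝ) + 1)) :=
          Real.rpow_le_rpow (Nat.cast_nonneg _) h2 hexp
      _ = (N : ℝ) / D * C ^ ((n : ℝ) + 1)⁻¹ := by
          rw [Real.mul_rpow (pow_nonneg hND _) hC.le, one_div]
          congr 1
          have : ((n : ℝ) + 1) = ((n + 1 : ℕ) : ℝ) := by push_cast; ring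
          rw [this, Real.pow_rpow_inv_natCast hND hn]
  have hlim : Tendsto (fun n : ℕ => (N : ℝ) / D * C ^ ((n : ℝ) + 1)⁻¹) atTop (𝓝 ((N : ℝ) / D)) := by
    have := (tendsto_const_rpow_inv hC).const_mul ((N : ℝ) / D)
    rwa [mul_one] at this
  exact ge_of_tendsto' hlim hle

end FiniteMemory

end Literature.Probability.RandomPlanarGeometry.SAW
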